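import Summits.NavierStokesRegularity.NavierStokesRegularity.Theorems.ExtremiserTransienceTwoThirdsChebyshev
import Summits.NavierStokesRegularity.NavierStokesRegularity.Theorems.ExtremiserTransienceTwoThirdsBridge
import Summits.NavierStokesRegularity.NavierStokesRegularity.Theorems.ExtremiserTransienceTwoThirdsLayerAverage
import HarnessLib

/-!
# Route `ExtremiserTransience`, crux `NearExtremalTransiencePerFlow` (stmt-NavierStokesRegularity-26567),
# LINE g10-1 «two_thirds» (ns-idea-10), stub S1a′ — BRICK 3b, lemma (iii): PER-TRANSLATE bad inner weight from the EXCESS MAJORANT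

`--supports stmt-NavierStokesRegularity-26567` (helper; prover seat ns-net-p2 g12; design = evidence #59 on ⟨26567⟩).  Normalised units.  For ONE translate
`τ` of the cubic packing (cells `B(g + τ, s)`, `g ∈ Λ_b`, spacing `4s`): the bad inner weight of brick 4a/4d,
`Σ_{g} 1_{Gᶜ}(g+τ) μ_Θ(B(g+τ, s/2))` with `G = {c : IsGoodBall w c s δ}`, is bounded by
`ofReal((ε/κ⋆ + e/(κ⋆ Z))(18/δ² + 2/δ) Z) + ofReal(δ⁻¹)·Σ_g (μ_b(B(g+τ, s')) − μ_b(B(g+τ, s)))`, `s' = s + s^{7/8}`, `μ_b = (zd+wd)dx`,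
as soon as the EXCESS of every finite family `F` of THICK cells of this translate (cells whose inner ball meets `Θ`) together with its remainder is
`≤ e` (`badWeight_translate_le`; finite partial sums → `sum_Zb_notGood_le` p727880 → `iSup`).  Also `isClosed_setOf_isGoodBall` (so `G` is
measurable) and `ball_withDensity_eq` (`μ_b(B(c,r)) = ofReal(Z_B + W_B)`).  The τ-integration (with `∫_Q e(τ) dτ` from brick 2 and the layer
average p727991) and bricks 4d/4b′/4e then give `TypicalSelectionNormalised`.
HONEST FRAMING: bookkeeping; nothing about Navier–Stokes is proved; no summit is proved by a line. [folklore]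
-/

noncomputable section

open scoped Topology InnerProductSpace RealInnerProductSpace ENNReal NNReal ContDiff
open MeasureTheory Filter Set Metric Function
open Literature.Analysis Literature.Analysis.FluidPDE
open Summit.NavierStokesRegularity.NavierStokesRegularity.Theorems.DepletionLadder
open Summit.NavierStokesRegularity.NavierStokesRegularity.Theorems.DepletionLadder.KStar.HalfSpace
open Summit.NavierStokesRegularity.NavierStokesRegularity.Theorems.DepletionLadder.KStar.BangBang
open Summit.NavierStokesRegularity.NavierStokesRegularity.Theorems.NearExtremalTransiencePerFlow.LocalMaximiser

namespace Summit.NavierStokesRegularity.NavierStokesRegularity.Theorems.NearExtremalTransiencePerFlow.TwoThirds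

-- the problem directory repeats the summit name (`NavierStokesRegularity/NavierStokesRegularity`)
set_option linter.dupNamespace false
set_option linter.style.longLine false

/-- **The set of good centres is closed** (uniform derivative budgets; `isGoodBall_of_limit` with a constant field sequence). -/
theorem isClosed_setOf_isGoodBall {w : E3 → E3} (hw : ContDiff ℝ (⊤ : ℕ∞) w)
    (hb : ∀ k : ℕ, ∃ C : ℝ, ∀ x, ‖iteratedFDeriv ℝ k w x‖ ≤ C) {s : ℝ} (hs : 0 ≤ s) (δ : ℝ) :
    IsClosed {c : E3 | IsGoodBall w c s δ} := by
  refine IsSeqClosed.isClosed fun c c' hmem hc => ?_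
  obtain ⟨Rc, hRc⟩ : ∃ Rc : ℝ, ∀ k, ‖c k‖ ≤ Rc := by
    obtain ⟨R, hR⟩ := (Metric.isBounded_range_of_tendsto c hc).exists_norm_le
    exact ⟨R, fun k => hR _ (Set.mem_range_self k)⟩
  exact isGoodBall_of_limit (Fn := fun _ => w) (fun _ => hw) hw
    (fun k => by obtain ⟨C, hC⟩ := hb k; exact ⟨C, fun _ x => hC x, hC⟩)
    (fun x => tendsto_const_nhds) hc tendsto_const_nhds hRc (fun _ => le_rfl) (fun _ => hs) hmem

/-- The bulk measure on balls: `((zd + wd) dx)(B(c, r)) = ofReal(Z_B + W_B)`. -/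
theorem ball_withDensity_eq {w : E3 → E3} (hz : Integrable (zd w)) (hwd : Integrable (wd w)) (c : E3) (r : ℝ) :
    (volume.withDensity fun x => ENNReal.ofReal (zd w x + wd w x)) (Metric.ball c r) = ENNReal.ofReal (Zb w c r + Wb w c r) := by
  have hi : Integrable (fun x => zd w x + wd w x) := hz.add hwd
  rw [withDensity_apply _ measurableSet_ball, ← ofReal_integral_eq_lintegral_ofReal hi.integrableOn
    (Eventually.of_forall fun x => add_nonneg (sq_nonneg _) (frobeniusNormSq_nonneg _))]
  unfold Zb Wb
  rw [integral_add hz.integrableOn hwd.integrableOn]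

open Classical in
/-- **Brick 3b (iii) — the bad inner weight of ONE translate from the excess majorant.**  See the module docstring. [folklore] -/
theorem badWeight_translate_le {A : ℕ → ℝ} {w : E3 → E3} {B ε : ℝ} (hadm : IsAdm w 1 B) (hZ : 0 < Zen w) (hW : 0 < Wpa w)
    (hlam : lam w = 1) (hext : (kStar - ε) * Real.sqrt (Zen w) * Real.sqrt (Wpa w) ≤ Jst w)
    {θ₀ s δ : ℝ} (hs : 0 < s) (hδ : 0 < δ) (hδ1 : δ ≤ 1 / 2)
    (b : Module.Basis (Fin 3) ℝ E3)
    (hbΛ : ∀ x : E3, x ∈ Submodule.span ℤ (Set.range b) ↔ ∀ j, ∃ n : ℤ, x j = 4 * s * n)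
    (τ : E3) {e : ℝ}
    (hEX : ∀ F : Finset E3, (∀ c ∈ F, c - τ ∈ Submodule.span ℤ (Set.range b)) →
      (∀ c ∈ F, ({x | θ₀ ≤ ‖curl w x‖} ∩ Metric.ball c (s / 2)).Nonempty) →
      (∑ c ∈ F, max (Jb w c s - kStar * Real.sqrt (Zb w c s * Wb w c s)) 0) +
        max ((∫ x in (⋃ c ∈ F, Metric.ball c s)ᶜ, sd w x) -
          kStar * Real.sqrt ((∫ x in (⋃ c ∈ F, Metric.ball c s)ᶜ, zd w x) * (∫ x in (⋃ c ∈ F, Metric.ball c s)ᶜ, wd w x))) 0 ≤ e) :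
    (∑' g : (Submodule.span ℤ (Set.range b)).toAddSubgroup,
        {c : E3 | IsGoodBall w c s δ}ᶜ.indicator
          (fun c => ((volume.restrict {x | θ₀ ≤ ‖curl w x‖}).withDensity (fun x => ENNReal.ofReal (‖curl w x‖ ^ 2))) (Metric.ball c (s / 2)))
          ((g : E3) + τ)) ≤
      ENNReal.ofReal ((ε / kStar + e / (kStar * Zen w)) * (18 / δ ^ 2 + 2 / δ) * Zen w) +
        ENNReal.ofReal δ⁻¹ * ∑' g : (Submodule.span ℤ (Set.range b)).toAddSubgroup,
          ((volume.withDensity fun x => ENNReal.ofReal (zd w x + wd w x)) (Metric.ball ((g : E3) + τ) (s + s ^ (7 / 8 : ℝ))) -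
            (volume.withDensity fun x => ENNReal.ofReal (zd w x + wd w x)) (Metric.ball ((g : E3) + τ) s)) := by
  obtain ⟨hv, hdiv, hvM, hvB, h0, h1, h2⟩ := id hadm
  have hv2 : ContDiff ℝ 2 w := hv.of_le (by norm_cast)
  have hv3 : ContDiff ℝ 3 w := hv.of_le (by norm_cast)
  have izd : Integrable (zd w) := (integrable_norm_curl_sq hv2 h1).1
  have iwd : Integrable (wd w) := (integrable_frobeniusNormSq_fderiv_curl hv3 h2).1
  have hκ : 0 < kStar := kStar_pos
  set Θ : Set E3 := {x | θ₀ ≤ ‖curl w x‖} with hΘ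
  set μΘ : Measure E3 := (volume.restrict Θ).withDensity (fun x => ENNReal.ofReal (‖curl w x‖ ^ 2)) with hμΘ
  set μb : Measure E3 := volume.withDensity (fun x => ENNReal.ofReal (zd w x + wd w x)) with hμb
  set G : Set E3 := {c : E3 | IsGoodBall w c s δ} with hG
  set Λ := (Submodule.span ℤ (Set.range b)).toAddSubgroup with hΛ
  set s' : ℝ := s + s ^ (7 / 8 : ℝ) with hs'
  have hss' : s ≤ s' := by rw [hs']; linarith [Real.rpow_nonneg hs.le (7 / 8 : ℝ)]
  -- separation of the cells of one translate
  have hsep : ∀ g g' : Λ, g ≠ g' → 4 * s ≤ dist ((g : E3) + τ) ((g' : E3) + τ) := by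
    intro g g' hne
    rw [dist_add_right]
    refine dist_ge_of_mem_cellLattice hs ((hbΛ _).1 g.2) ((hbΛ _).1 g'.2) ?_
    exact fun h => hne (Subtype.ext h)
  -- layer terms are the `μb`-layers
  have hlayer : ∀ c : E3, ENNReal.ofReal ((Zb w c s' + Wb w c s') - (Zb w c s + Wb w c s)) = μb (Metric.ball c s') - μb (Metric.ball c s) := by
    intro c
    rw [hμb, ball_withDensity_eq izd iwd, ball_withDensity_eq izd iwd,
      ENNReal.ofReal_sub _ (add_nonneg (Zb_nonneg _ _ _) (Wb_nonneg _ _ _))]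
  -- it suffices to bound every finite partial sum
  rw [ENNReal.tsum_eq_iSup_sum]
  refine iSup_le fun T => ?_
  -- the thick cells of `T`
  set Tth : Finset Λ := T.filter (fun g => (Θ ∩ Metric.ball ((g : E3) + τ) (s / 2)).Nonempty) with hTth
  set F : Finset E3 := Tth.map ⟨fun g : Λ => (g : E3) + τ, fun g g' h => Subtype.ext (add_right_cancel h)⟩ with hF
  -- cells of `T` that are not thick contribute nothing
  have hzero : ∀ g ∈ T, g ∉ Tth → Gᶜ.indicator (fun c => μΘ (Metric.ball c (s / 2))) ((g : E3) + τ) = 0 := by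
    intro g hgT hg
    have hempty : Θ ∩ Metric.ball ((g : E3) + τ) (s / 2) = ∅ := by
      by_contra hne
      exact hg (Finset.mem_filter.2 ⟨hgT, Set.nonempty_iff_ne_empty.2 hne⟩)
    have hμ0 : μΘ (Metric.ball ((g : E3) + τ) (s / 2)) = 0 := by
      rw [hμΘ, thickMeasure_apply izd measurableSet_ball, hempty]
      simp
    by_cases hmem : ((g : E3) + τ) ∈ Gᶜ
    · rw [Set.indicator_of_mem hmem, hμ0]
    · rw [Set.indicator_of_notMem hmem]
  have hsplit : ∑ g ∈ T, Gᶜ.indicator (fun c => μΘ (Metric.ball c (s / 2))) ((g : E3) + τ) =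
      ∑ g ∈ Tth, Gᶜ.indicator (fun c => μΘ (Metric.ball c (s / 2))) ((g : E3) + τ) := by
    rw [hTth, Finset.sum_filter_of_ne]
    intro g hgT hne
    by_contra hnot
    exact hne (hzero g hgT (by rw [hTth]; exact fun h => hnot (Finset.mem_filter.1 h).2))
  -- thick cells: `1_{Gᶜ} μΘ(inner) ≤ 1_{¬good} ofReal(Zb)`
  have hcell : ∀ g ∈ Tth, Gᶜ.indicator (fun c => μΘ (Metric.ball c (s / 2))) ((g : E3) + τ) ≤
      ENNReal.ofReal (if IsGoodBall w ((g : E3) + τ) s δ then 0 else Zb w ((g : E3) + τ) s) := by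
    intro g _
    by_cases hgood : IsGoodBall w ((g : E3) + τ) s δ
    · rw [Set.indicator_of_notMem (by simpa [hG] using hgood), if_pos hgood]; simp
    · rw [Set.indicator_of_mem (by simpa [hG] using hgood), if_neg hgood, hμΘ]
      have h := thickMeasure_ball_le izd (Θ := Θ) ((g : E3) + τ) (show s / 2 ≤ s by linarith)
      unfold Zb zd; exact h
  -- the real Chebyshev bound on `F`
  have hFΛ : ∀ c ∈ F, c - τ ∈ Submodule.span ℤ (Set.range b) := by
    intro c hc
    rw [hF, Finset.mem_map] at hc
    obtain ⟨g, -, rfl⟩ := hc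
    simp only [Function.Embedding.coeFn_mk, add_sub_cancel_right]
    exact g.2
  have hFth : ∀ c ∈ F, (Θ ∩ Metric.ball c (s / 2)).Nonempty := by
    intro c hc
    rw [hF, Finset.mem_map] at hc
    obtain ⟨g, hg, rfl⟩ := hc
    exact (Finset.mem_filter.1 hg).2
  have hFsep : ∀ c ∈ F, ∀ c' ∈ F, c ≠ c' → 2 * s ≤ dist c c' := by
    intro c hc c' hc' hne
    rw [hF, Finset.mem_map] at hc hc'
    obtain ⟨g, -, rfl⟩ := hc
    obtain ⟨g', -, rfl⟩ := hc'
    have hgg : g ≠ g' := fun h => hne (by rw [h])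
    change 2 * s ≤ dist ((g : E3) + τ) ((g' : E3) + τ)
    linarith [hsep g g' hgg]
  have hcheb := sum_Zb_notGood_le (A := A) hadm hZ hW hlam hext hs hδ hδ1 F hFsep (hEX F hFΛ hFth)
  -- assemble in `ℝ≥0∞`
  have hR : ∑ c ∈ F.filter (fun c => ¬ IsGoodBall w c s δ), Zb w c s = ∑ c ∈ F, (if IsGoodBall w c s δ then 0 else Zb w c s) := by
    rw [Finset.sum_filter]
    exact Finset.sum_congr rfl fun c _ => by by_cases h : IsGoodBall w c s δ <;> simp [h]
  have hsumF : ∑ g ∈ Tth, ENNReal.ofReal (if IsGoodBall w ((g : E3) + τ) s δ then 0 else Zb w ((g : E3) + τ) s) =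
      ENNReal.ofReal (∑ c ∈ F.filter (fun c => ¬ IsGoodBall w c s δ), Zb w c s) := by
    rw [hR, hF, ENNReal.ofReal_sum_of_nonneg]
    · simp only [Finset.sum_map, Function.Embedding.coeFn_mk]
    · intro c _
      by_cases h : IsGoodBall w c s δ <;> simp [h, Zb_nonneg]
  have hlayF : ENNReal.ofReal (δ⁻¹ * ∑ c ∈ F, ((Zb w c s' + Wb w c s') - (Zb w c s + Wb w c s))) ≤
      ENNReal.ofReal δ⁻¹ * ∑' g : Λ, (μb (Metric.ball ((g : E3) + τ) s') - μb (Metric.ball ((g : E3) + τ) s)) := by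
    rw [ENNReal.ofReal_mul (inv_nonneg.2 hδ.le)]
    gcongr
    have hlay_nonneg : ∀ c : E3, 0 ≤ (Zb w c s' + Wb w c s') - (Zb w c s + Wb w c s) := by
      intro c
      have hsub : Metric.ball c s ⊆ Metric.ball c s' := Metric.ball_subset_ball hss'
      linarith [Zb_mono hv hsub, Wb_mono hv hsub]
    rw [ENNReal.ofReal_sum_of_nonneg (fun c _ => hlay_nonneg c), hF]
    simp only [Finset.sum_map, Function.Embedding.coeFn_mk]
    calc ∑ g ∈ Tth, ENNReal.ofReal ((Zb w ((g : E3) + τ) s' + Wb w ((g : E3) + τ) s') - (Zb w ((g : E3) + τ) s + Wb w ((g : E3) + τ) s))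
        = ∑ g ∈ Tth, (μb (Metric.ball ((g : E3) + τ) s') - μb (Metric.ball ((g : E3) + τ) s)) :=
          Finset.sum_congr rfl fun g _ => hlayer _
      _ ≤ ∑' g : Λ, (μb (Metric.ball ((g : E3) + τ) s') - μb (Metric.ball ((g : E3) + τ) s)) := ENNReal.sum_le_tsum _
  calc ∑ g ∈ T, Gᶜ.indicator (fun c => μΘ (Metric.ball c (s / 2))) ((g : E3) + τ)
      = ∑ g ∈ Tth, Gᶜ.indicator (fun c => μΘ (Metric.ball c (s / 2))) ((g : E3) + τ) := hsplit
    _ ≤ ∑ g ∈ Tth, ENNReal.ofReal (if IsGoodBall w ((g : E3) + τ) s δ then 0 else Zb w ((g : E3) + τ) s) := Finset.sum_le_sum hcell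
    _ = ENNReal.ofReal (∑ c ∈ F.filter (fun c => ¬ IsGoodBall w c s δ), Zb w c s) := hsumF
    _ ≤ ENNReal.ofReal ((ε / kStar + e / (kStar * Zen w)) * (18 / δ ^ 2 + 2 / δ) * Zen w +
          δ⁻¹ * ∑ c ∈ F, ((Zb w c s' + Wb w c s') - (Zb w c s + Wb w c s))) := ENNReal.ofReal_le_ofReal hcheb
    _ ≤ ENNReal.ofReal ((ε / kStar + e / (kStar * Zen w)) * (18 / δ ^ 2 + 2 / δ) * Zen w) +
          ENNReal.ofReal (δ⁻¹ * ∑ c ∈ F, ((Zb w c s' + Wb w c s') - (Zb w c s + Wb w c s))) := ENNReal.ofReal_add_le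
    _ ≤ _ := by gcongr

end Summit.NavierStokesRegularity.NavierStokesRegularity.Theorems.NearExtremalTransiencePerFlow.TwoThirds

end
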